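import Summits.AtomisticToContinuum.BoseEinsteinCondensation.Theorems.BECInsertionCorrectorStaticResponseBoundModePairing
import HarnessLib

/-!
# The weighted completed square for the static response bound (few-body half, every coupling), I:
# torus calculus (line `stable-fraction-square-completion`, seat a1; item stmt-AtomisticToContinuum-12057 —
# this file supports, does not close, the item)

Helper file 1/3 of the registered stub `stub_allCouplingPT` (seat-a1 skeleton of crux
`BECInsertionCorrector.StaticResponseBound`).  For real `C¹` lattice-periodic `F, θ`, the phases `θⱼ = p·xⱼ`
(`p = 2πk/L`), `V = ∑ⱼcos θⱼ` and the FORCE FIELD `B = ∑ⱼ sin θⱼ ∑_c p_c ∂_{j,c}F`: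

* `pt5_weightedSq_axis` / `_particle` / `_sum` — the completed square with drift `u sin θⱼ` (`u = tp_c/|p|²`) AGAINST THE
  WEIGHT `F²`: `0 ≤ t∫Vθ²F² + κ𝓔_F(θ) + (t²N/(κ|p|²))∫θ²F² + (2t/|p|²)∫B θ²F` for every `κ > 0` (pointwise square plus
  the flux identity `modePairing_axis` for the flux `sin θⱼ θ²F²`, summed over axes and particles; `sin² ≤ 1`,
  `∑_c p_c² = |p|²`); `pt5_meanFlux` — `|p|²∫VF² + 2∫B F = 0` (the same flux identity with the constant test function);
* `pt5_forceField_sq_le` — `B² ≤ N|p|²|∇F|²` pointwise (Cauchy–Schwarz twice).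

At `F ≡ const` this is the free square of `…FreeSquare`; files 2/3–3/3 control the cross term `∫Bθ²F`.  Folklore.
-/

noncomputable section

namespace Summit.AtomisticToContinuum.BoseEinsteinCondensation.Cruxes.StaticResponseBound.FewBody5

open MeasureTheory Filter
open scoped ENNReal NNReal BigOperators Topology
open Literature.MathematicalPhysics.QuantumManyBody.BoseGas
open Summit.AtomisticToContinuum.BoseEinsteinCondensation.Theses
open Summit.AtomisticToContinuum.BoseEinsteinCondensation.Theses.BECInsertionCorrector
open Summit.AtomisticToContinuum.BoseEinsteinCondensation.Theorems.StaticResponseBound.Negative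
open Summit.AtomisticToContinuum.BoseEinsteinCondensation.Cruxes.StaticResponseBound.UvThomsonForceWave
open Summit.AtomisticToContinuum.BoseEinsteinCondensation.Cruxes.StaticResponseBound.FewBody

variable {N : ℕ} {L : ℝ}

/-! ## The weighted completed square, one particle and one axis -/

/-- `θ²` is a periodic test function if `θ` is. [folklore] -/
theorem pt5_isPeriodicTest_sq {θ : Config N → ℝ} (hθ : IsPeriodicTest L θ) :
    IsPeriodicTest L fun X => θ X ^ 2 :=
  ⟨hθ.1.pow 2, fun X i kk => by
    show θ _ ^ 2 = θ X ^ 2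
    rw [hθ.2 X i kk]⟩

/-- **The weighted completed square for particle `j` and axis `c`.**  For real `C¹` lattice-periodic `F, θ`, the
phase `Θ = θⱼ`, `p = p_c = 2πk_c/L`, `κ > 0` and real `P`, `t`:
`0 ≤ (tp²/P)∫cosΘ θ²F² + κ∫(∂_{j,c}θ)²F² + (t²p²/(κP²))∫sin²Θ θ²F² + (2tp/P)∫sinΘ ∂_{j,c}F θ²F`
(pointwise square `κ(∂θ)²F² + (u²/κ)sin²Θθ²F² − 2u sinΘ θ∂θF² ≥ 0`, `u = tp/P`, plus `u` times the flux identity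
`modePairing_axis` for the flux `sinΘ θ²F²`). [folklore] -/
theorem pt5_weightedSq_axis (hL : 0 < L) {k : Fin 3 → ℤ} {F θ : Config N → ℝ}
    (hF : IsPeriodicTest L F) (hθ : IsPeriodicTest L θ)
    {j : Fin N} {c : Fin 3} {Θ : Config N → ℝ} {p : ℝ}
    (hΘ : ∀ X, Θ X = 2 * Real.pi / L * ∑ i, (k i : ℝ) * X j i) (hp : p = 2 * Real.pi / L * k c)
    {κ : ℝ} (hκ : 0 < κ) (P t : ℝ) :
    0 ≤ t * p ^ 2 / P * (∫ X in cellN N L, Real.cos (Θ X) * θ X ^ 2 * F X ^ 2)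
        + κ * (∫ X in cellN N L, pderiv j c θ X ^ 2 * F X ^ 2)
        + t ^ 2 * p ^ 2 / (κ * P ^ 2) * (∫ X in cellN N L, Real.sin (Θ X) ^ 2 * θ X ^ 2 * F X ^ 2)
        + 2 * t * p / P * (∫ X in cellN N L, Real.sin (Θ X) * pderiv j c F X * (θ X ^ 2 * F X)) := by
  -- regularity
  have hθd : Differentiable ℝ θ := hθ.differentiable
  have hFc : Continuous F := hF.continuous
  have hθc : Continuous θ := hθ.continuous
  have hdFc : Continuous (pderiv j c F) := continuous_pderiv hF.1 j c
  have hdθc : Continuous (pderiv j c θ) := continuous_pderiv hθ.1 j c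
  have hΘc : Continuous Θ := by rw [funext hΘ]; fun_prop
  -- the flux identity for `sin Θ · θ² F²`
  have hflux := modePairing_axis hL hF (pt5_isPeriodicTest_sq hθ) (j := j) (c := c) hΘ hp
  have hps : ∀ X, pderiv j c (fun Y => θ Y ^ 2) X = 2 * θ X * pderiv j c θ X :=
    fun X => pderiv_fun_sq (hθd X) j c
  simp_rw [hps] at hflux
  -- the pointwise completed square
  set u : ℝ := t * p / P with hu
  have hpt : ∀ X, 0 ≤ κ * (pderiv j c θ X ^ 2 * F X ^ 2)
      + u ^ 2 / κ * (Real.sin (Θ X) ^ 2 * θ X ^ 2 * F X ^ 2)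
      - u * (Real.sin (Θ X) * (2 * θ X * pderiv j c θ X) * F X ^ 2) := by
    intro X
    have hsq := sq_nonneg (κ * pderiv j c θ X * F X - u * Real.sin (Θ X) * θ X * F X)
    have e : κ * (pderiv j c θ X ^ 2 * F X ^ 2)
        + u ^ 2 / κ * (Real.sin (Θ X) ^ 2 * θ X ^ 2 * F X ^ 2)
        - u * (Real.sin (Θ X) * (2 * θ X * pderiv j c θ X) * F X ^ 2) =
        (κ * pderiv j c θ X * F X - u * Real.sin (Θ X) * θ X * F X) ^ 2 / κ := by
      field_simp
      ring
    rw [e]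
    exact div_nonneg hsq hκ.le
  -- integrability (continuous functions on the bounded cell)
  have hi2 : Integrable (fun X => pderiv j c θ X ^ 2 * F X ^ 2) (volume.restrict (cellN N L)) :=
    integrableOn_cellN ((hdθc.pow 2).mul (hFc.pow 2)) L
  have hi3 : Integrable (fun X => Real.sin (Θ X) ^ 2 * θ X ^ 2 * F X ^ 2) (volume.restrict (cellN N L)) :=
    integrableOn_cellN ((((Real.continuous_sin.comp hΘc).pow 2).mul (hθc.pow 2)).mul (hFc.pow 2)) L
  have hi5 : Integrable (fun X => Real.sin (Θ X) * (2 * θ X * pderiv j c θ X) * F X ^ 2)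
      (volume.restrict (cellN N L)) :=
    integrableOn_cellN (((Real.continuous_sin.comp hΘc).mul ((continuous_const.mul hθc).mul hdθc)).mul
      (hFc.pow 2)) L
  -- the square, integrated and expanded by linearity
  have hS : 0 ≤ ∫ X in cellN N L, (κ * (pderiv j c θ X ^ 2 * F X ^ 2)
      + u ^ 2 / κ * (Real.sin (Θ X) ^ 2 * θ X ^ 2 * F X ^ 2)
      - u * (Real.sin (Θ X) * (2 * θ X * pderiv j c θ X) * F X ^ 2)) := integral_nonneg hpt
  have hlin : ∫ X in cellN N L, (κ * (pderiv j c θ X ^ 2 * F X ^ 2)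
      + u ^ 2 / κ * (Real.sin (Θ X) ^ 2 * θ X ^ 2 * F X ^ 2)
      - u * (Real.sin (Θ X) * (2 * θ X * pderiv j c θ X) * F X ^ 2)) =
      κ * (∫ X in cellN N L, pderiv j c θ X ^ 2 * F X ^ 2)
        + u ^ 2 / κ * (∫ X in cellN N L, Real.sin (Θ X) ^ 2 * θ X ^ 2 * F X ^ 2)
        - u * (∫ X in cellN N L, Real.sin (Θ X) * (2 * θ X * pderiv j c θ X) * F X ^ 2) := by
    have hi23 : Integrable (fun X => κ * (pderiv j c θ X ^ 2 * F X ^ 2)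
        + u ^ 2 / κ * (Real.sin (Θ X) ^ 2 * θ X ^ 2 * F X ^ 2)) (volume.restrict (cellN N L)) :=
      (hi2.const_mul _).add (hi3.const_mul _)
    rw [integral_sub hi23 (hi5.const_mul _), integral_add (hi2.const_mul _) (hi3.const_mul _),
      integral_const_mul, integral_const_mul, integral_const_mul]
  rw [hlin] at hS
  -- combine with `u` times the flux identity
  have hcomb : t * p ^ 2 / P * (∫ X in cellN N L, Real.cos (Θ X) * θ X ^ 2 * F X ^ 2)
        + κ * (∫ X in cellN N L, pderiv j c θ X ^ 2 * F X ^ 2)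
        + t ^ 2 * p ^ 2 / (κ * P ^ 2) * (∫ X in cellN N L, Real.sin (Θ X) ^ 2 * θ X ^ 2 * F X ^ 2)
        + 2 * t * p / P * (∫ X in cellN N L, Real.sin (Θ X) * pderiv j c F X * (θ X ^ 2 * F X)) =
      (κ * (∫ X in cellN N L, pderiv j c θ X ^ 2 * F X ^ 2)
        + u ^ 2 / κ * (∫ X in cellN N L, Real.sin (Θ X) ^ 2 * θ X ^ 2 * F X ^ 2)
        - u * (∫ X in cellN N L, Real.sin (Θ X) * (2 * θ X * pderiv j c θ X) * F X ^ 2))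
      + u * (p * (∫ X in cellN N L, Real.cos (Θ X) * θ X ^ 2 * F X ^ 2)
        + (∫ X in cellN N L, Real.sin (Θ X) * (2 * θ X * pderiv j c θ X) * F X ^ 2)
        + 2 * (∫ X in cellN N L, Real.sin (Θ X) * pderiv j c F X * (θ X ^ 2 * F X))) := by
    rw [hu]
    field_simp
    ring
  rw [hcomb, hflux, mul_zero, add_zero]
  exact hS

/-! ## The weighted completed square, summed over axes and particles -/

/-- **The weighted square for particle `j`** (sum of `pt5_weightedSq_axis` over the axes, `P = |p|²`,
`∑_c p_c² = |p|²`, `sin² ≤ 1`):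
`0 ≤ t∫cosθⱼ θ²F² + κ∑_c∫(∂_{j,c}θ)²F² + (t²/(κ|p|²))∫θ²F² + (2t/|p|²)∫ sinθⱼ (∑_c p_c∂_{j,c}F) θ²F`. [folklore] -/
theorem pt5_weightedSq_particle (hL : 0 < L) {k : Fin 3 → ℤ} (hk : k ≠ 0) {F θ : Config N → ℝ}
    (hF : IsPeriodicTest L F) (hθ : IsPeriodicTest L θ) (j : Fin N) {Θ : Config N → ℝ}
    (hΘ : ∀ X, Θ X = 2 * Real.pi / L * ∑ i, (k i : ℝ) * X j i)
    {p : Fin 3 → ℝ} (hp : ∀ c, p c = 2 * Real.pi / L * k c) {κ : ℝ} (hκ : 0 < κ) (t : ℝ) :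
    0 ≤ t * (∫ X in cellN N L, Real.cos (Θ X) * θ X ^ 2 * F X ^ 2)
        + κ * (∑ c, ∫ X in cellN N L, pderiv j c θ X ^ 2 * F X ^ 2)
        + t ^ 2 / (κ * psq L k) * (∫ X in cellN N L, θ X ^ 2 * F X ^ 2)
        + 2 * t / psq L k *
          (∫ X in cellN N L, Real.sin (Θ X) * (∑ c, p c * pderiv j c F X) * (θ X ^ 2 * F X)) := by
  have hP : 0 < psq L k := freeSq_psq_pos hL hk
  have hPsum : psq L k = ∑ c, p c ^ 2 := by
    rw [freeSq_psq_eq_sum]; exact Finset.sum_congr rfl fun c _ => by rw [hp]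
  have hFc : Continuous F := hF.continuous
  have hθc : Continuous θ := hθ.continuous
  have hΘc : Continuous Θ := by rw [funext hΘ]; fun_prop
  have hdFc : ∀ c, Continuous (pderiv j c F) := fun c => continuous_pderiv hF.1 j c
  -- sum of the axis squares
  have h := Finset.sum_nonneg fun c (_ : c ∈ Finset.univ) =>
    pt5_weightedSq_axis hL hF hθ (j := j) (c := c) hΘ (hp c) hκ (psq L k) t
  rw [Finset.sum_add_distrib, Finset.sum_add_distrib, Finset.sum_add_distrib] at h
  -- first term: `∑_c t p_c²/P · I₁ = t I₁`
  have e1 : ∑ c, t * p c ^ 2 / psq L k * (∫ X in cellN N L, Real.cos (Θ X) * θ X ^ 2 * F X ^ 2) =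
      t * ∫ X in cellN N L, Real.cos (Θ X) * θ X ^ 2 * F X ^ 2 := by
    rw [← Finset.sum_mul, ← Finset.sum_div, ← Finset.mul_sum, ← hPsum]
    field_simp
  -- second term
  have e2 : ∑ c, κ * (∫ X in cellN N L, pderiv j c θ X ^ 2 * F X ^ 2) =
      κ * ∑ c, ∫ X in cellN N L, pderiv j c θ X ^ 2 * F X ^ 2 := by rw [Finset.mul_sum]
  -- third term: `∑_c t²p_c²/(κP²) I₅ = (t²/(κP)) I₅ ≤ (t²/(κP)) ∫ θ²F²`
  have e3 : ∑ c, t ^ 2 * p c ^ 2 / (κ * psq L k ^ 2) *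
        (∫ X in cellN N L, Real.sin (Θ X) ^ 2 * θ X ^ 2 * F X ^ 2) =
      t ^ 2 / (κ * psq L k) * ∫ X in cellN N L, Real.sin (Θ X) ^ 2 * θ X ^ 2 * F X ^ 2 := by
    rw [← Finset.sum_mul, ← Finset.sum_div, ← Finset.mul_sum, ← hPsum]
    field_simp
  have h3 : t ^ 2 / (κ * psq L k) * (∫ X in cellN N L, Real.sin (Θ X) ^ 2 * θ X ^ 2 * F X ^ 2) ≤
      t ^ 2 / (κ * psq L k) * ∫ X in cellN N L, θ X ^ 2 * F X ^ 2 := by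
    refine mul_le_mul_of_nonneg_left ?_ (by positivity)
    refine setIntegral_mono_on (integrableOn_cellN (by fun_prop) L)
      (integrableOn_cellN ((hθc.pow 2).mul (hFc.pow 2)) L) (measurableSet_cellN N L) fun X _ => ?_
    have hs : Real.sin (Θ X) ^ 2 ≤ 1 := by
      rw [sq_le_one_iff_abs_le_one]; exact Real.abs_sin_le_one _
    have h0 : 0 ≤ θ X ^ 2 * F X ^ 2 := by positivity
    nlinarith
  -- fourth term: `∑_c (2tp_c/P) ∫ sinΘ ∂_{j,c}F θ²F = (2t/P) ∫ sinΘ (∑_c p_c ∂_{j,c}F) θ²F`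
  have hi4 : ∀ c, Integrable (fun X => Real.sin (Θ X) * pderiv j c F X * (θ X ^ 2 * F X))
      (volume.restrict (cellN N L)) := fun c =>
    integrableOn_cellN ((((Real.continuous_sin.comp hΘc).mul (hdFc c))).mul ((hθc.pow 2).mul hFc)) L
  have e4 : ∑ c, 2 * t * p c / psq L k *
        (∫ X in cellN N L, Real.sin (Θ X) * pderiv j c F X * (θ X ^ 2 * F X)) =
      2 * t / psq L k *
        ∫ X in cellN N L, Real.sin (Θ X) * (∑ c, p c * pderiv j c F X) * (θ X ^ 2 * F X) := by
    have e41 : ∀ c, 2 * t * p c / psq L k *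
        (∫ X in cellN N L, Real.sin (Θ X) * pderiv j c F X * (θ X ^ 2 * F X)) =
        2 * t / psq L k * ∫ X in cellN N L, p c * (Real.sin (Θ X) * pderiv j c F X * (θ X ^ 2 * F X)) := by
      intro c
      rw [integral_const_mul]
      ring
    rw [Finset.sum_congr rfl fun c _ => e41 c, ← Finset.mul_sum,
      ← integral_finsetSum _ fun c _ => (hi4 c).const_mul (p c)]
    congr 1
    refine integral_congr_ae (ae_of_all _ fun X => ?_)
    dsimp only
    rw [Finset.mul_sum, Finset.sum_mul]
    exact Finset.sum_congr rfl fun c _ => by ring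
  rw [e1, e2, e3, e4] at h
  linarith

/-- **The weighted completed square, summed** (`pt5_weightedSq_particle` over the particles; `𝓔_F(θ) = ∫|∇θ|²F²`,
`V = ∑ⱼcosθⱼ`, `B = ∑ⱼ sinθⱼ ∑_c p_c∂_{j,c}F`):
`0 ≤ t∫Vθ²F² + κ𝓔_F(θ) + (t²N/(κ|p|²))∫θ²F² + (2t/|p|²)∫B θ²F`. [folklore] -/
theorem pt5_weightedSq_sum (hL : 0 < L) {k : Fin 3 → ℤ} (hk : k ≠ 0) {F θ : Config N → ℝ}
    (hF : IsPeriodicTest L F) (hθ : IsPeriodicTest L θ) {Θ : Fin N → Config N → ℝ}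
    (hΘ : ∀ j X, Θ j X = 2 * Real.pi / L * ∑ i, (k i : ℝ) * X j i)
    {p : Fin 3 → ℝ} (hp : ∀ c, p c = 2 * Real.pi / L * k c) {κ : ℝ} (hκ : 0 < κ) (t : ℝ) :
    0 ≤ t * (∫ X in cellN N L, (∑ j, Real.cos (Θ j X)) * θ X ^ 2 * F X ^ 2)
        + κ * dirichletFormW L F θ θ
        + t ^ 2 * N / (κ * psq L k) * (∫ X in cellN N L, θ X ^ 2 * F X ^ 2)
        + 2 * t / psq L k *
          (∫ X in cellN N L, (∑ j, Real.sin (Θ j X) * ∑ c, p c * pderiv j c F X) * (θ X ^ 2 * F X)) := by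
  have hFc : Continuous F := hF.continuous
  have hθc : Continuous θ := hθ.continuous
  have hΘc : ∀ j, Continuous (Θ j) := fun j => by rw [funext (hΘ j)]; fun_prop
  have hdFc : ∀ j c, Continuous (pderiv j c F) := fun j c => continuous_pderiv hF.1 j c
  have hdθc : ∀ j c, Continuous (pderiv j c θ) := fun j c => continuous_pderiv hθ.1 j c
  -- sum of the particle squares
  have h := Finset.sum_nonneg fun j (_ : j ∈ Finset.univ) =>
    pt5_weightedSq_particle hL hk hF hθ j (hΘ j) hp hκ t
  rw [Finset.sum_add_distrib, Finset.sum_add_distrib, Finset.sum_add_distrib] at h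
  -- integrability
  have hi1 : ∀ j, Integrable (fun X => Real.cos (Θ j X) * θ X ^ 2 * F X ^ 2)
      (volume.restrict (cellN N L)) := fun j =>
    integrableOn_cellN (((Real.continuous_cos.comp (hΘc j)).mul (hθc.pow 2)).mul (hFc.pow 2)) L
  have hi2 : ∀ j c, Integrable (fun X => pderiv j c θ X ^ 2 * F X ^ 2) (volume.restrict (cellN N L)) :=
    fun j c => integrableOn_cellN (((hdθc j c).pow 2).mul (hFc.pow 2)) L
  have hi4 : ∀ j, Integrable
      (fun X => Real.sin (Θ j X) * (∑ c, p c * pderiv j c F X) * (θ X ^ 2 * F X))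
      (volume.restrict (cellN N L)) := fun j =>
    integrableOn_cellN (((Real.continuous_sin.comp (hΘc j)).mul
      (continuous_finsetSum _ fun c _ => continuous_const.mul (hdFc j c))).mul ((hθc.pow 2).mul hFc)) L
  -- first term
  have e1 : ∑ j, t * (∫ X in cellN N L, Real.cos (Θ j X) * θ X ^ 2 * F X ^ 2) =
      t * ∫ X in cellN N L, (∑ j, Real.cos (Θ j X)) * θ X ^ 2 * F X ^ 2 := by
    rw [← Finset.mul_sum, ← integral_finsetSum _ fun j _ => hi1 j]
    congr 1
    refine integral_congr_ae (ae_of_all _ fun X => ?_)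
    dsimp only
    rw [Finset.sum_mul, Finset.sum_mul]
  -- second term: the Dirichlet form
  have e2 : ∑ j, κ * (∑ c, ∫ X in cellN N L, pderiv j c θ X ^ 2 * F X ^ 2) = κ * dirichletFormW L F θ θ := by
    rw [← Finset.mul_sum]
    congr 1
    unfold dirichletFormW
    have hexp : (fun X => gradDot θ θ X * F X ^ 2) = fun X => ∑ j, ∑ c, pderiv j c θ X ^ 2 * F X ^ 2 := by
      funext X
      unfold gradDot
      rw [Finset.sum_mul]
      refine Finset.sum_congr rfl fun j _ => ?_
      rw [Finset.sum_mul]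
      exact Finset.sum_congr rfl fun c _ => by ring
    rw [hexp, integral_finsetSum _ fun j _ => integrable_finsetSum _ fun c _ => hi2 j c]
    refine Finset.sum_congr rfl fun j _ => ?_
    rw [integral_finsetSum _ fun c _ => hi2 j c]
  -- third term
  have e3 : ∑ _j : Fin N, t ^ 2 / (κ * psq L k) * (∫ X in cellN N L, θ X ^ 2 * F X ^ 2) =
      t ^ 2 * N / (κ * psq L k) * ∫ X in cellN N L, θ X ^ 2 * F X ^ 2 := by
    rw [Finset.sum_const, Finset.card_univ, Fintype.card_fin, nsmul_eq_mul]
    ring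
  -- fourth term
  have e4 : ∑ j, 2 * t / psq L k *
        (∫ X in cellN N L, Real.sin (Θ j X) * (∑ c, p c * pderiv j c F X) * (θ X ^ 2 * F X)) =
      2 * t / psq L k *
        ∫ X in cellN N L, (∑ j, Real.sin (Θ j X) * ∑ c, p c * pderiv j c F X) * (θ X ^ 2 * F X) := by
    rw [← Finset.mul_sum, ← integral_finsetSum _ fun j _ => hi4 j]
    congr 1
    refine integral_congr_ae (ae_of_all _ fun X => ?_)
    dsimp only
    rw [Finset.sum_mul]
  rw [e1, e2, e3, e4] at h
  exact h

/-! ## The mean flux identity and the Cauchy–Schwarz bounds on the force field `B` -/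

/-- **The mean flux identity** `|p|²∫VF² + 2∫B·F = 0`, `B = ∑ⱼ sinθⱼ ∑_c p_c∂_{j,c}F`
(`modePairing_axis` with the constant test function, summed). [folklore] -/
theorem pt5_meanFlux (hL : 0 < L) {k : Fin 3 → ℤ} {F : Config N → ℝ} (hF : IsPeriodicTest L F)
    {Θ : Fin N → Config N → ℝ} (hΘ : ∀ j X, Θ j X = 2 * Real.pi / L * ∑ i, (k i : ℝ) * X j i)
    {p : Fin 3 → ℝ} (hp : ∀ c, p c = 2 * Real.pi / L * k c) :
    psq L k * (∫ X in cellN N L, (∑ j, Real.cos (Θ j X)) * F X ^ 2)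
      + 2 * (∫ X in cellN N L, (∑ j, Real.sin (Θ j X) * ∑ c, p c * pderiv j c F X) * F X) = 0 := by
  have hPsum : psq L k = ∑ c, p c ^ 2 := by
    rw [freeSq_psq_eq_sum]; exact Finset.sum_congr rfl fun c _ => by rw [hp]
  have hFc : Continuous F := hF.continuous
  have hΘc : ∀ j, Continuous (Θ j) := fun j => by rw [funext (hΘ j)]; fun_prop
  have hdFc : ∀ j c, Continuous (pderiv j c F) := fun j c => continuous_pderiv hF.1 j c
  -- per particle and axis
  have hax : ∀ j c, p c * (∫ X in cellN N L, Real.cos (Θ j X) * F X ^ 2)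
      + 2 * (∫ X in cellN N L, Real.sin (Θ j X) * pderiv j c F X * F X) = 0 := by
    intro j c
    have h := modePairing_axis hL hF (IsPeriodicTest.const L (1 : ℝ)) (j := j) (c := c) (hΘ j) (hp c)
    simp only [pderiv_const, mul_one, one_mul, mul_zero, zero_mul, integral_zero, add_zero] at h
    exact h
  -- per particle: multiply by `p_c` and sum over the axes
  have hi1 : ∀ j, Integrable (fun X => Real.cos (Θ j X) * F X ^ 2) (volume.restrict (cellN N L)) :=
    fun j => integrableOn_cellN ((Real.continuous_cos.comp (hΘc j)).mul (hFc.pow 2)) L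
  have hi2 : ∀ j c, Integrable (fun X => Real.sin (Θ j X) * pderiv j c F X * F X)
      (volume.restrict (cellN N L)) := fun j c =>
    integrableOn_cellN (((Real.continuous_sin.comp (hΘc j)).mul (hdFc j c)).mul hFc) L
  have hpart : ∀ j, psq L k * (∫ X in cellN N L, Real.cos (Θ j X) * F X ^ 2)
      + 2 * (∫ X in cellN N L, (Real.sin (Θ j X) * ∑ c, p c * pderiv j c F X) * F X) = 0 := by
    intro j
    have h := Finset.sum_eq_zero fun c (_ : c ∈ Finset.univ) =>
      show p c * (p c * (∫ X in cellN N L, Real.cos (Θ j X) * F X ^ 2)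
        + 2 * (∫ X in cellN N L, Real.sin (Θ j X) * pderiv j c F X * F X)) = 0 by
        rw [hax j c, mul_zero]
    have e : ∀ c, p c * (p c * (∫ X in cellN N L, Real.cos (Θ j X) * F X ^ 2)
        + 2 * (∫ X in cellN N L, Real.sin (Θ j X) * pderiv j c F X * F X)) =
        p c ^ 2 * (∫ X in cellN N L, Real.cos (Θ j X) * F X ^ 2)
        + 2 * (∫ X in cellN N L, p c * (Real.sin (Θ j X) * pderiv j c F X * F X)) := by
      intro c
      rw [integral_const_mul]
      ring
    simp_rw [e] at h
    rw [Finset.sum_add_distrib, ← Finset.sum_mul, ← hPsum, ← Finset.mul_sum,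
      ← integral_finsetSum _ fun c _ => (hi2 j c).const_mul (p c)] at h
    have e2 : (∫ X in cellN N L, ∑ c, p c * (Real.sin (Θ j X) * pderiv j c F X * F X)) =
        ∫ X in cellN N L, (Real.sin (Θ j X) * ∑ c, p c * pderiv j c F X) * F X := by
      refine integral_congr_ae (ae_of_all _ fun X => ?_)
      dsimp only
      rw [Finset.mul_sum, Finset.sum_mul]
      exact Finset.sum_congr rfl fun c _ => by ring
    rw [e2] at h
    exact h
  -- sum over the particles
  have hi3 : ∀ j, Integrable (fun X => (Real.sin (Θ j X) * ∑ c, p c * pderiv j c F X) * F X)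
      (volume.restrict (cellN N L)) := fun j =>
    integrableOn_cellN (((Real.continuous_sin.comp (hΘc j)).mul
      (continuous_finsetSum _ fun c _ => continuous_const.mul (hdFc j c))).mul hFc) L
  have h := Finset.sum_eq_zero fun j (_ : j ∈ Finset.univ) => hpart j
  rw [Finset.sum_add_distrib, ← Finset.mul_sum, ← Finset.mul_sum,
    ← integral_finsetSum _ fun j _ => hi1 j, ← integral_finsetSum _ fun j _ => hi3 j] at h
  have e3 : (∫ X in cellN N L, ∑ j, Real.cos (Θ j X) * F X ^ 2) =
      ∫ X in cellN N L, (∑ j, Real.cos (Θ j X)) * F X ^ 2 := by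
    refine integral_congr_ae (ae_of_all _ fun X => ?_)
    dsimp only
    rw [Finset.sum_mul]
  have e4 : (∫ X in cellN N L, ∑ j, (Real.sin (Θ j X) * ∑ c, p c * pderiv j c F X) * F X) =
      ∫ X in cellN N L, (∑ j, Real.sin (Θ j X) * ∑ c, p c * pderiv j c F X) * F X := by
    refine integral_congr_ae (ae_of_all _ fun X => ?_)
    dsimp only
    rw [Finset.sum_mul]
  rw [e3, e4] at h
  exact h

/-- **Pointwise bound on the force field**: `B² ≤ N|p|²|∇F|²` (Cauchy–Schwarz twice, `sin² ≤ 1`,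
`∑_c p_c² = |p|²`). [folklore] -/
theorem pt5_forceField_sq_le {k : Fin 3 → ℤ} (F : Config N → ℝ) (Θ : Fin N → Config N → ℝ)
    {p : Fin 3 → ℝ} (hp : ∀ c, p c = 2 * Real.pi / L * k c) (X : Config N) :
    (∑ j, Real.sin (Θ j X) * ∑ c, p c * pderiv j c F X) ^ 2 ≤ N * psq L k * gradDot F F X := by
  have hPsum : psq L k = ∑ c, p c ^ 2 := by
    rw [freeSq_psq_eq_sum]; exact Finset.sum_congr rfl fun c _ => by rw [hp]
  -- outer Cauchy–Schwarz
  have h1 := Finset.sum_mul_sq_le_sq_mul_sq Finset.univ (fun j => Real.sin (Θ j X))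
    (fun j => ∑ c, p c * pderiv j c F X)
  have h2 : ∑ j : Fin N, Real.sin (Θ j X) ^ 2 ≤ N := by
    have h := Finset.sum_le_sum fun j (_ : j ∈ (Finset.univ : Finset (Fin N))) =>
      show Real.sin (Θ j X) ^ 2 ≤ 1 by rw [sq_le_one_iff_abs_le_one]; exact Real.abs_sin_le_one _
    rwa [Finset.sum_const, Finset.card_univ, Fintype.card_fin, nsmul_eq_mul, mul_one] at h
  -- inner Cauchy–Schwarz
  have h3 : ∀ j, (∑ c, p c * pderiv j c F X) ^ 2 ≤ psq L k * ∑ c, pderiv j c F X ^ 2 := by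
    intro j
    rw [hPsum]
    exact Finset.sum_mul_sq_le_sq_mul_sq Finset.univ (fun c => p c) (fun c => pderiv j c F X)
  have h4 : ∑ j, (∑ c, p c * pderiv j c F X) ^ 2 ≤ psq L k * gradDot F F X := by
    unfold gradDot
    rw [Finset.mul_sum]
    refine Finset.sum_le_sum fun j _ => ?_
    refine (h3 j).trans (le_of_eq ?_)
    congr 1
    exact Finset.sum_congr rfl fun c _ => by ring
  have h5 : 0 ≤ ∑ j, (∑ c, p c * pderiv j c F X) ^ 2 := Finset.sum_nonneg fun j _ => sq_nonneg _
  have hg : 0 ≤ gradDot F F X := gradDot_self_nonneg F X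
  have hP : 0 ≤ psq L k := by rw [hPsum]; exact Finset.sum_nonneg fun c _ => sq_nonneg _
  calc (∑ j, Real.sin (Θ j X) * ∑ c, p c * pderiv j c F X) ^ 2
      ≤ (∑ j, Real.sin (Θ j X) ^ 2) * ∑ j, (∑ c, p c * pderiv j c F X) ^ 2 := h1
    _ ≤ N * (psq L k * gradDot F F X) :=
        mul_le_mul h2 h4 h5 (Nat.cast_nonneg N)
    _ = N * psq L k * gradDot F F X := by ring

/-- **Registered form `pt5_weightedSq_sum_closed`** of `pt5_weightedSq_sum` (explicit phases, closed statement):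
the weighted completed square summed over particles and axes. [folklore] -/
theorem pt5_weightedSq_sum_closed :
    ∀ (N : ℕ) (L : ℝ), 0 < L → ∀ (k : Fin 3 → ℤ), k ≠ 0 → ∀ (F θ : Config N → ℝ),
      IsPeriodicTest L F → IsPeriodicTest L θ → ∀ (κ : ℝ), 0 < κ → ∀ t : ℝ,
      0 ≤ t * (∫ X in cellN N L, (∑ j, Real.cos (2 * Real.pi / L * ∑ i, (k i : ℝ) * X j i)) * θ X ^ 2 * F X ^ 2)
        + κ * dirichletFormW L F θ θ
        + t ^ 2 * N / (κ * psq L k) * (∫ X in cellN N L, θ X ^ 2 * F X ^ 2)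
        + 2 * t / psq L k *
          (∫ X in cellN N L, (∑ j, Real.sin (2 * Real.pi / L * ∑ i, (k i : ℝ) * X j i) *
            ∑ c, 2 * Real.pi / L * (k c : ℝ) * pderiv j c F X) * (θ X ^ 2 * F X)) :=
  fun _N L hL k hk _F _θ hF hθ _κ hκ t =>
    pt5_weightedSq_sum hL hk hF hθ (Θ := fun j X => 2 * Real.pi / L * ∑ i, (k i : ℝ) * X j i)
      (fun _ _ => rfl) (p := fun c => 2 * Real.pi / L * k c) (fun _ => rfl) hκ t

end Summit.AtomisticToContinuum.BoseEinsteinCondensation.Cruxes.StaticResponseBound.FewBody5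

end
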